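import Literature.NumberTheory.NumberFields.HilbertClassFieldArtinIsomorphism
import Literature.NumberTheory.NumberFields.AmbiguousClassGaloisAction
import HarnessLib

/-!
# The Artin isomorphism of the Hilbert class field is equivariant: `(H/K, σ𝔞) = τ̃ ∘ (H/K, 𝔞) ∘ τ̃⁻¹`
# (Neukirch, *Algebraic Number Theory*, Ch. VI (7.1) with Ch. IV §6; Okazaki 2000, proof of Prop. 27)

Topic `NumberTheory/NumberFields` (class field theory); namespace
`Literature.NumberTheory.NumberFields.hilbertClassField`.  Theorem-only file (no definition, no named
fact, no `sorry`), unconditional; sequel of `HilbertClassFieldArtinIsomorphism.lean` (the Artin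
isomorphism `artinEquiv : Cl(𝓞 K) ≃* Gal(H/K)` of `H = hilbertClassField K ⊆ K̄`, characterised by
`artinEquiv [𝔭] = Frob_𝔭`) and `AmbiguousClassGaloisAction.lean` (an automorphism `σ` of `K` acting on
`Cl(𝓞 K)` through `ClassGroup.mulEquiv (AmbiguousClass.intAut σ)`).

> Neukirch, Ch. VI §7 Thm. (7.1): the Artin symbol of the Hilbert class field sends the class of a
> prime `𝔭` to its Frobenius; Ch. IV §6: the norm residue symbol is functorial in isomorphisms of
> fields, `(σL|σK, σa) = σ̃ (L|K, a) σ̃⁻¹`.  Okazaki, *Acta Arith.* 92 (2000), proof of Prop. 27: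
> "Noting also that `σ` acts on a field `K` which contains `H`, we get an isomorphism
> `Gal(H/k) ≃ C_k/C` of `σ`-modules by class field theory."

**Statement proved.**  Let `τ̃` be any automorphism of `H = hilbertClassField K` (linear over some
subfield `E`) which restricts to the automorphism `σ` of `K` (`τ̃ ∘ i = i ∘ σ`, `i : K → H`).  Then for
every ideal class `c` of `K` and every `y ∈ H`,
`artinEquiv (σ • c) y = τ̃ (artinEquiv c (τ̃⁻¹ y))`, i.e. `(H/K, σ𝔞) = τ̃ ∘ (H/K, 𝔞) ∘ τ̃⁻¹`
(`artinEquiv_mulEquiv_intAut_apply`).  Ingredients: the conjugate `τ̃ φ τ̃⁻¹` of `φ ∈ Gal(H/K)` is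
again `K`-linear (`exists_algEquiv_conj`); if `φ` is an arithmetic Frobenius at a prime `𝔔` of `H` then
`τ̃ φ τ̃⁻¹` is one at `τ̃𝔔`, which lies over `σ(𝔔 ∩ K)` with the same residue cardinality
(`isArithFrobAt_conj`; Mathlib's `IsArithFrobAt.conj` is the case `σ = 1`); both sides are
multiplicative in `c` and the prime classes generate `Cl(𝓞 K)`.  Typical use: `K` a CM field, `E = K⁺`,
`σ` = complex conjugation, `τ̃` a lift to `H` (`H/K⁺` is Galois, `HilbertClassFieldOfGaloisExtension.lean`).

## References

* J. Neukirch, *Algebraic Number Theory*, Grundlehren 322 (1999), Ch. IV §6, Ch. VI §7 Thm. (7.1). [NeukirchANT1999]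
* R. Okazaki, *Inclusion of CM-fields and divisibility of relative class numbers*, Acta Arith. 92 (2000)
  319–338, §5, proof of Prop. 27. [Okazaki2000]
* D. A. Cox, *Primes of the form x² + ny²*, 2nd ed. (2013), §8.A Thm. 8.10. [Cox2013]
-/

noncomputable section

open NumberField IsDedekindDomain Field
open scoped nonZeroDivisors Pointwise

namespace Literature.NumberTheory.NumberFields

open Literature.NumberTheory.GaloisRepresentations

namespace hilbertClassField

variable (K : Type) [Field K] [NumberField K]
variable {E E' : Type*} [Field E] [Field E'] [Algebra E (hilbertClassField K)] [Algebra E' K]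

/-- On integers, `τ̃ ∘ i = i ∘ σ` (`i : 𝓞 K → 𝓞 H`). [folklore] -/
private theorem forward_int (τ : hilbertClassField K ≃ₐ[E] hilbertClassField K) (σ : K ≃ₐ[E'] K)
    (hτ : ∀ x : K, τ (algebraMap K (hilbertClassField K) x) = algebraMap K (hilbertClassField K) (σ x))
    (w : 𝓞 K) :
    AmbiguousClass.intAut τ (algebraMap (𝓞 K) (𝓞 (hilbertClassField K)) w) =
      algebraMap (𝓞 K) (𝓞 (hilbertClassField K)) (AmbiguousClass.intAut σ w) := by
  apply Subtype.ext
  change ((AmbiguousClass.intAut τ (algebraMap (𝓞 K) (𝓞 (hilbertClassField K)) w) :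
      𝓞 (hilbertClassField K)) : hilbertClassField K) =
    ((algebraMap (𝓞 K) (𝓞 (hilbertClassField K)) (AmbiguousClass.intAut σ w) :
      𝓞 (hilbertClassField K)) : hilbertClassField K)
  have h1 : ((algebraMap (𝓞 K) (𝓞 (hilbertClassField K)) w : 𝓞 (hilbertClassField K)) :
      hilbertClassField K) = algebraMap K (hilbertClassField K) (w : K) := rfl
  have h2 : ((algebraMap (𝓞 K) (𝓞 (hilbertClassField K)) (AmbiguousClass.intAut σ w) :
      𝓞 (hilbertClassField K)) : hilbertClassField K) =
      algebraMap K (hilbertClassField K) ((AmbiguousClass.intAut σ w : 𝓞 K) : K) := rfl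
  rw [RingOfIntegers.mapRingEquiv_apply, h1, h2, RingOfIntegers.mapRingEquiv_apply]
  exact hτ (w : K)

/-- If `τ` restricts to `σ` on `K` then `τ⁻¹` restricts to `σ⁻¹` (on integers). [folklore] -/
private theorem backward_int (τ : hilbertClassField K ≃ₐ[E] hilbertClassField K) (σ : K ≃ₐ[E'] K)
    (hτ : ∀ x : K, τ (algebraMap K (hilbertClassField K) x) = algebraMap K (hilbertClassField K) (σ x))
    (x : 𝓞 K) :
    (AmbiguousClass.intAut τ).symm (algebraMap (𝓞 K) (𝓞 (hilbertClassField K)) x) =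
      algebraMap (𝓞 K) (𝓞 (hilbertClassField K)) ((AmbiguousClass.intAut σ).symm x) := by
  apply (AmbiguousClass.intAut τ).injective
  rw [RingEquiv.apply_symm_apply, forward_int K τ σ hτ, RingEquiv.apply_symm_apply]

/-- `(τ Q) ∩ 𝓞_K = σ(Q ∩ 𝓞_K)` for any ideal `Q` of `𝓞_H`. [folklore] -/
private theorem under_map_intAut (τ : hilbertClassField K ≃ₐ[E] hilbertClassField K) (σ : K ≃ₐ[E'] K)
    (hτ : ∀ x : K, τ (algebraMap K (hilbertClassField K) x) = algebraMap K (hilbertClassField K) (σ x))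
    (Q : Ideal (𝓞 (hilbertClassField K))) :
    (Q.map (AmbiguousClass.intAut τ : 𝓞 (hilbertClassField K) →+* 𝓞 (hilbertClassField K))).under
        (𝓞 K) =
      (Q.under (𝓞 K)).map (AmbiguousClass.intAut σ : 𝓞 K →+* 𝓞 K) := by
  ext x
  simp only [Ideal.under_def, Ideal.mem_comap]
  rw [Ideal.mem_map_iff_of_surjective (AmbiguousClass.intAut τ : _ →+* _)
      (fun z => ⟨(AmbiguousClass.intAut τ).symm z, (AmbiguousClass.intAut τ).apply_symm_apply z⟩),
    Ideal.mem_map_iff_of_surjective (AmbiguousClass.intAut σ : _ →+* _)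
      (fun z => ⟨(AmbiguousClass.intAut σ).symm z, (AmbiguousClass.intAut σ).apply_symm_apply z⟩)]
  constructor
  · rintro ⟨z, hz, hzx⟩
    refine ⟨(AmbiguousClass.intAut σ).symm x, ?_, (AmbiguousClass.intAut σ).apply_symm_apply x⟩
    rw [Ideal.mem_comap, ← backward_int K τ σ hτ]
    have : z = (AmbiguousClass.intAut τ).symm (algebraMap (𝓞 K) (𝓞 (hilbertClassField K)) x) := by
      rw [← hzx, RingHom.coe_coe, RingEquiv.symm_apply_apply]
    rwa [← this]
  · rintro ⟨w, hw, hwx⟩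
    refine ⟨algebraMap (𝓞 K) (𝓞 (hilbertClassField K)) w, (Ideal.mem_comap.mp hw), ?_⟩
    rw [RingHom.coe_coe, forward_int K τ σ hτ, ← hwx, RingHom.coe_coe]

/-- If `τ` restricts to `σ` on `K` then `τ⁻¹` restricts to `σ⁻¹`. [folklore] -/
private theorem backward (τ : hilbertClassField K ≃ₐ[E] hilbertClassField K) (σ : K ≃ₐ[E'] K)
    (hτ : ∀ x : K, τ (algebraMap K (hilbertClassField K) x) = algebraMap K (hilbertClassField K) (σ x))
    (x : K) : τ.symm (algebraMap K (hilbertClassField K) x) =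
      algebraMap K (hilbertClassField K) (σ.symm x) := by
  apply τ.injective
  rw [AlgEquiv.apply_symm_apply, hτ, AlgEquiv.apply_symm_apply]

/-- Membership in the transported ideal: `y ∈ e(I) ↔ e⁻¹ y ∈ I`. [folklore] -/
private theorem mem_map_ringEquiv_iff {R : Type*} [CommRing R] (e : R ≃+* R) (I : Ideal R) (y : R) :
    y ∈ I.map (e : R →+* R) ↔ e.symm y ∈ I := by
  rw [Ideal.map_comap_of_equiv, Ideal.mem_comap]

/-- **The conjugate `τ ∘ φ ∘ τ⁻¹` of `φ ∈ Gal(H/K)` by an automorphism `τ` of `H` restricting to an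
automorphism `σ` of `K` is again in `Gal(H/K)`** (given pointwise; `H = hilbertClassField K`).
[cite: NeukirchANT1999, Ch. IV §6 (functoriality of the norm residue symbol) and Ch. VI §7 Thm. (7.1)] -/
theorem exists_algEquiv_conj (τ : hilbertClassField K ≃ₐ[E] hilbertClassField K) (σ : K ≃ₐ[E'] K)
    (hτ : ∀ x : K, τ (algebraMap K (hilbertClassField K) x) = algebraMap K (hilbertClassField K) (σ x))
    (φ : hilbertClassField K ≃ₐ[K] hilbertClassField K) :
    ∃ φ' : hilbertClassField K ≃ₐ[K] hilbertClassField K, ∀ y, φ' y = τ (φ (τ.symm y)) := by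
  refine ⟨AlgEquiv.ofRingEquiv (f := τ.toRingEquiv.symm.trans (φ.toRingEquiv.trans τ.toRingEquiv))
    fun k => ?_, fun y => rfl⟩
  change τ (φ (τ.symm (algebraMap K (hilbertClassField K) k))) = algebraMap K (hilbertClassField K) k
  rw [backward K τ σ hτ, AlgEquiv.commutes, hτ, AlgEquiv.apply_symm_apply]

/-- **Transport of Frobenius: if `φ` is an arithmetic Frobenius at the prime `𝔔` of `H`, then
`τ φ τ⁻¹` is an arithmetic Frobenius at `τ𝔔`** — also when `τ` moves the base field `K` (by `σ`):
`N(τ𝔔 ∩ K) = N(σ(𝔔 ∩ K)) = N(𝔔 ∩ K)`. (Mathlib's `IsArithFrobAt.conj` is the case `σ = 1`.)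
[cite: NeukirchANT1999, Ch. IV §6 (functoriality of the norm residue symbol) and Ch. VI §7 Thm. (7.1)] -/
theorem isArithFrobAt_conj (τ : hilbertClassField K ≃ₐ[E] hilbertClassField K) (σ : K ≃ₐ[E'] K)
    (hτ : ∀ x : K, τ (algebraMap K (hilbertClassField K) x) = algebraMap K (hilbertClassField K) (σ x))
    {Q : Ideal (𝓞 (hilbertClassField K))} {φ φ' : hilbertClassField K ≃ₐ[K] hilbertClassField K}
    (hφ : IsArithFrobAt (𝓞 K) φ Q) (hφ' : ∀ y, φ' y = τ (φ (τ.symm y))) :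
    IsArithFrobAt (𝓞 K) φ'
      (Q.map (AmbiguousClass.intAut τ : 𝓞 (hilbertClassField K) →+* 𝓞 (hilbertClassField K))) := by
  intro z
  rw [under_map_intAut K τ σ hτ Q,
    Nat.card_congr (Ideal.quotientEquiv (Q.under (𝓞 K)) _ (AmbiguousClass.intAut σ) rfl).symm.toEquiv,
    mem_map_ringEquiv_iff, map_sub, map_pow]
  have h1 : (AmbiguousClass.intAut τ).symm
      (MulSemiringAction.toAlgHom (𝓞 K) (𝓞 (hilbertClassField K)) φ' z) =
      MulSemiringAction.toAlgHom (𝓞 K) (𝓞 (hilbertClassField K)) φ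
        ((AmbiguousClass.intAut τ).symm z) := by
    apply Subtype.ext
    change τ.symm (φ' (z : hilbertClassField K)) = φ (τ.symm (z : hilbertClassField K))
    rw [hφ', AlgEquiv.symm_apply_apply]
  rw [h1]
  exact hφ _

omit [NumberField K] in
/-- `σ(𝔭)` is a nonzero prime of `K` for a nonzero prime `𝔭`. [folklore] -/
private theorem isPrime_map_intAut (σ : K ≃ₐ[E'] K) (v : HeightOneSpectrum (𝓞 K)) :
    (v.asIdeal.map (AmbiguousClass.intAut σ : 𝓞 K →+* 𝓞 K)).IsPrime := by
  rw [Ideal.map_comap_of_equiv]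
  exact Ideal.IsPrime.comap _ (hK := v.isPrime)

omit [NumberField K] in
/-- `σ(𝔭) ≠ 0`. [folklore] -/
private theorem map_intAut_ne_bot (σ : K ≃ₐ[E'] K) (v : HeightOneSpectrum (𝓞 K)) :
    v.asIdeal.map (AmbiguousClass.intAut σ : 𝓞 K →+* 𝓞 K) ≠ ⊥ := by
  exact nonZeroDivisors.ne_zero
    (AmbiguousClass.map_mem_nonZeroDivisors σ ⟨v.asIdeal, asIdeal_mem_nonZeroDivisors v⟩)

/-- **The Artin isomorphism of the Hilbert class field is equivariant: `(H/K, σ𝔞) = τ̃ ∘ (H/K, 𝔞) ∘ τ̃⁻¹`**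
for every automorphism `τ̃` of `H = hilbertClassField K` restricting to the automorphism `σ` of `K`
(`σ` acting on `Cl(𝓞 K)` through `ClassGroup.mulEquiv (AmbiguousClass.intAut σ)`).  Pointwise form:
`artinEquiv (σ • c) y = τ̃ (artinEquiv c (τ̃⁻¹ y))`.  Proof: both sides are multiplicative in `c`, the
prime classes generate, and for a prime `𝔭` with Frobenius `φ` at `𝔔 ∣ 𝔭` the conjugate `τ̃φτ̃⁻¹` is
the Frobenius at `τ̃𝔔 ∣ σ𝔭` (`isArithFrobAt_conj`).
[cite: NeukirchANT1999, Ch. IV §6 (functoriality of the norm residue symbol) and Ch. VI §7 Thm. (7.1)] -/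
theorem artinEquiv_mulEquiv_intAut_apply (τ : hilbertClassField K ≃ₐ[E] hilbertClassField K)
    (σ : K ≃ₐ[E'] K)
    (hτ : ∀ x : K, τ (algebraMap K (hilbertClassField K) x) = algebraMap K (hilbertClassField K) (σ x))
    (c : ClassGroup (𝓞 K)) (y : hilbertClassField K) :
    artinEquiv K (ClassGroup.mulEquiv (AmbiguousClass.intAut σ) c) y =
      τ (artinEquiv K c (τ.symm y)) := by
  classical
  obtain ⟨I, rfl⟩ := ClassGroup.mk0_surjective c
  have hI : (I : Ideal (𝓞 K)) ≠ ⊥ := nonZeroDivisors.coe_ne_zero I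
  revert y
  have key : ∀ (J : Ideal (𝓞 K)) (hJ : J ≠ ⊥) (y : hilbertClassField K),
      artinEquiv K (ClassGroup.mulEquiv (AmbiguousClass.intAut σ)
        (ClassGroup.mk0 ⟨J, mem_nonZeroDivisors_of_ne_zero hJ⟩)) y =
      τ (artinEquiv K (ClassGroup.mk0 ⟨J, mem_nonZeroDivisors_of_ne_zero hJ⟩) (τ.symm y)) := by
    intro J
    induction J using UniqueFactorizationMonoid.induction_on_prime with
    | h₁ => intro hJ; exact absurd rfl hJ
    | h₂ J hJu =>
      intro hJ y
      have h1 : ClassGroup.mk0 ⟨J, mem_nonZeroDivisors_of_ne_zero hJ⟩ = 1 := by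
        obtain ⟨u, rfl⟩ := hJu
        have : (⟨(u : Ideal (𝓞 K)), mem_nonZeroDivisors_of_ne_zero hJ⟩ : (Ideal (𝓞 K))⁰) = 1 := by
          apply Subtype.ext
          simp [Ideal.isUnit_iff.mp u.isUnit]
        rw [this, map_one]
      rw [h1, map_one, map_one, AlgEquiv.one_apply, AlgEquiv.one_apply, AlgEquiv.apply_symm_apply]
    | h₃ J P hJ0 hP ih =>
      intro hJP y
      have hP0 : P ≠ ⊥ := hP.ne_zero
      have hmul : (⟨P * J, mem_nonZeroDivisors_of_ne_zero hJP⟩ : (Ideal (𝓞 K))⁰) =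
          ⟨P, mem_nonZeroDivisors_of_ne_zero hP0⟩ * ⟨J, mem_nonZeroDivisors_of_ne_zero hJ0⟩ :=
        Subtype.ext rfl
      -- the prime `P`: Frobenius transport
      have hPprime : P.IsPrime := Ideal.isPrime_of_prime hP
      set v : HeightOneSpectrum (𝓞 K) := ⟨P, hPprime, hP0⟩ with hv
      set v' : HeightOneSpectrum (𝓞 K) :=
        ⟨P.map (AmbiguousClass.intAut σ : 𝓞 K →+* 𝓞 K), isPrime_map_intAut K σ v,
          map_intAut_ne_bot K σ v⟩ with hv'
      obtain ⟨Q, hQ, hφ⟩ := galFrob_spec K (hilbertClassField K) v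
      obtain ⟨φ', hφ'⟩ := exists_algEquiv_conj K τ σ hτ (galFrob K (hilbertClassField K) v)
      have hQ' : Q.map (AmbiguousClass.intAut τ : 𝓞 (hilbertClassField K) →+* 𝓞 (hilbertClassField K)) ∈
          v'.asIdeal.primesOver (𝓞 (hilbertClassField K)) := by
        haveI : Q.IsPrime := hQ.1
        refine ⟨?_, ⟨?_⟩⟩
        · rw [Ideal.map_comap_of_equiv]
          exact Ideal.IsPrime.comap _
        · rw [under_map_intAut K τ σ hτ Q, ← hQ.2.over]
      have h1 : ClassGroup.mulEquiv (AmbiguousClass.intAut σ)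
          (ClassGroup.mk0 ⟨P, mem_nonZeroDivisors_of_ne_zero hP0⟩) =
          ClassGroup.mk0 ⟨v'.asIdeal, asIdeal_mem_nonZeroDivisors v'⟩ := by
        rw [AmbiguousClass.mulEquiv_mk0]
      have h2 : ClassGroup.mk0 ⟨P, mem_nonZeroDivisors_of_ne_zero hP0⟩ =
          ClassGroup.mk0 ⟨v.asIdeal, asIdeal_mem_nonZeroDivisors v⟩ := rfl
      have hprime : ∀ w : hilbertClassField K,
          artinEquiv K (ClassGroup.mulEquiv (AmbiguousClass.intAut σ)
            (ClassGroup.mk0 ⟨P, mem_nonZeroDivisors_of_ne_zero hP0⟩)) w =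
          τ (artinEquiv K (ClassGroup.mk0 ⟨P, mem_nonZeroDivisors_of_ne_zero hP0⟩) (τ.symm w)) := by
        intro w
        rw [h1, artinEquiv_mk0_eq_of_isArithFrobAt K hQ' (isArithFrobAt_conj K τ σ hτ hφ hφ'), h2,
          artinEquiv_mk0_eq_galFrob, hφ']
      rw [hmul, map_mul, map_mul, map_mul, map_mul, AlgEquiv.mul_apply, AlgEquiv.mul_apply, ih hJ0,
        hprime, AlgEquiv.symm_apply_apply]
  have : I = ⟨(I : Ideal (𝓞 K)), mem_nonZeroDivisors_of_ne_zero hI⟩ := Subtype.ext rfl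
  rw [this]
  exact key _ hI

end hilbertClassField

end Literature.NumberTheory.NumberFields

end
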